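import Mathlib
import HarnessLib

/-!
# The nonuniform Fisher inequality (Majumdar 1953) and the de Bruijn–Erdős bound for linear spaces

S. Jukna, *Extremal Combinatorics — with applications in computer science* (1st ed., Springer 2001)
[Jukna2001], Chapter 14 "The basic method" (the linear algebra method), §14.2.1 "Fisher's
inequality", Theorem 14.6 with the proof printed there (a variation of the argument of
Babai–Frankl [BabaiFrankl1992]); original: K. N. Majumdar, Ann. Math. Statistics 24 (1953) 377–389
[Majumdar1953]; and Chapter 13 §13.2, Theorem 13.4 (de Bruijn–Erdős 1948) — the inequality
`|𝓛| ≥ |X|` for finite linear spaces, obtained here from Theorem 14.6 by duality.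

**Theorem 14.6 (Fisher's inequality, nonuniform).** Let `A_1, …, A_m` be distinct subsets of
`{1, …, n}` such that `|A_i ∩ A_j| = k` for some fixed `1 ≤ k ≤ n` and every `i ≠ j`. Then `m ≤ n`.

PROVED here (theorems only, no named facts). The printed proof shows that the incidence vectors are
linearly independent over `ℝ` by expanding `‖Σ λ_i v_i‖²`; we obtain the same linear independence
(over `ℚ`) from the linear relations `Σ_i λ_i |A_i ∩ B| = 0` (`B` a member) directly: writing
`Λ = Σ λ_i`, they read `λ_B (|B| − k) + k Λ = 0`; at most one member has exactly `k` elements and all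
others have more, which forces `Λ = 0` and then every `λ_B = 0`.
* `sum_mul_card_inter_eq_zero` — a linear relation among incidence vectors gives
  `Σ_A λ_A |A ∩ B| = 0` for every `B`.
* `le_card_of_card_inter_eq`, `eq_of_card_eq_of_card_inter_eq` — members have `≥ k` elements, at
  most one has exactly `k` ("Clearly, `|A_i| ≥ k` for all `i` and `|A_i| = k` for at most one `i`").
* `linearIndependent_indicator_of_card_inter_eq` — the incidence vectors are linearly independent.
* **`nonuniform_fisher`** — Theorem 14.6.
* **`card_points_le_card_lines`** — Theorem 13.4 (de Bruijn–Erdős 1948), inequality part: in a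
  finite linear space with at least two lines (every line has `≥ 2` points, any two points lie on
  exactly one line), `|X| ≤ |𝓛|`; by Theorem 14.6 with `k = 1` applied to the pencils
  `A_x = {L ∋ x}`.  (Mathlib has the abstract-configuration form `Configuration.HasLines.card_le`;
  the tree has the `2`-design Fisher inequality `Literature.Combinatorics.Designs.Design.fisher_inequality`.)

## References

* [Jukna2001] S. Jukna, *Extremal Combinatorics*, 1st ed., Springer (2001), Theorem 14.6 and its
  proof (held text `book:jukna2011-extremal-combinatorics-with-applications-computer-science`,
  chunks 172–173), Theorem 13.4 (chunks 158–159).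
* [Majumdar1953] K. N. Majumdar, *On some theorems in combinatorics relating to incomplete block
  designs*, Ann. Math. Statistics 24 (1953) 377–389.
* [BabaiFrankl1992] L. Babai, P. Frankl, *Linear Algebra Methods in Combinatorics*, Univ. of Chicago
  (1992).
-/

namespace Literature.Combinatorics.SetFamily

open Finset

variable {α : Type*} [DecidableEq α]

/-! ### Incidence vectors and the relations `Σ λ_A |A ∩ B| = 0` -/

/-- `⟨v_A, v_B⟩ = |A ∩ B|`: summing the incidence vector of `A` over `B` counts `A ∩ B`.
[cite: Jukna2001, Ch. 14 §14.2.1, proof of Theorem 14.6 ("`⟨v_i, v_j⟩ = |A_i ∩ A_j|`")] -/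
theorem sum_indicator_eq_card_inter (A B : Finset α) :
    ∑ a ∈ B, (if a ∈ A then (1 : ℚ) else 0) = ((A ∩ B).card : ℚ) := by
  rw [Finset.sum_boole, Finset.filter_mem_eq_inter, Finset.inter_comm]

/-- A linear relation `Σ_A λ_A v_A = 0` among incidence vectors yields, after pairing with `v_B`,
`Σ_A λ_A |A ∩ B| = 0`. [cite: Jukna2001, Ch. 14 §14.2.1, proof of Theorem 14.6] -/
theorem sum_mul_card_inter_eq_zero {ι : Type*} (s : Finset ι) (S : ι → Finset α) (g : ι → ℚ)
    (hrel : ∑ i ∈ s, g i • (fun a => if a ∈ S i then (1 : ℚ) else 0) = 0) (B : Finset α) :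
    ∑ i ∈ s, g i * ((S i ∩ B).card : ℚ) = 0 := by
  calc ∑ i ∈ s, g i * ((S i ∩ B).card : ℚ)
      = ∑ i ∈ s, ∑ a ∈ B, g i * (if a ∈ S i then (1 : ℚ) else 0) := by
        refine Finset.sum_congr rfl fun i _ => ?_
        rw [← Finset.mul_sum, sum_indicator_eq_card_inter]
    _ = ∑ a ∈ B, (∑ i ∈ s, g i • (fun a => if a ∈ S i then (1 : ℚ) else 0)) a := by
        rw [Finset.sum_comm]
        refine Finset.sum_congr rfl fun a _ => ?_
        simp only [Finset.sum_apply, Pi.smul_apply, smul_eq_mul]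
    _ = 0 := by rw [hrel]; simp

/-! ### Theorem 14.6 -/

/-- In a family with at least two members and all pairwise intersections of size `k`, every member
has at least `k` elements. [cite: Jukna2001, Ch. 14 §14.2.1, proof of Theorem 14.6
("Clearly, `|A_i| ≥ k` for all `i`")] -/
theorem le_card_of_card_inter_eq {𝓕 : Finset (Finset α)} {k : ℕ} (h2 : 1 < 𝓕.card)
    (h𝓕 : ∀ A ∈ 𝓕, ∀ B ∈ 𝓕, A ≠ B → (A ∩ B).card = k) {A : Finset α} (hA : A ∈ 𝓕) :
    k ≤ A.card := by
  obtain ⟨B, hB, hBA⟩ := Finset.exists_mem_ne h2 A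
  rw [← h𝓕 A hA B hB hBA.symm]
  exact Finset.card_le_card Finset.inter_subset_left

/-- … and at most one member has exactly `k` elements. [cite: Jukna2001, Ch. 14 §14.2.1, proof of
Theorem 14.6 ("and `|A_i| = k` for at most one `i`")] -/
theorem eq_of_card_eq_of_card_inter_eq {𝓕 : Finset (Finset α)} {k : ℕ}
    (h𝓕 : ∀ A ∈ 𝓕, ∀ B ∈ 𝓕, A ≠ B → (A ∩ B).card = k) {A B : Finset α} (hA : A ∈ 𝓕)
    (hB : B ∈ 𝓕) (hAk : A.card = k) (hBk : B.card = k) : A = B := by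
  by_contra hne
  have h1 := h𝓕 A hA B hB hne
  have hAB : A ∩ B = A :=
    Finset.eq_of_subset_of_card_le Finset.inter_subset_left (by rw [h1, hAk])
  have hBA : A ∩ B = B :=
    Finset.eq_of_subset_of_card_le Finset.inter_subset_right (by rw [h1, hBk])
  exact hne (hAB.symm.trans hBA)

/-- **The incidence vectors of a family with constant pairwise intersection size `k ≥ 1` (and at
least two members) are linearly independent** (over `ℚ`). [cite: Jukna2001, Ch. 14 §14.2.1, proof of
Theorem 14.6; Majumdar1953; BabaiFrankl1992] -/
theorem linearIndependent_indicator_of_card_inter_eq {𝓕 : Finset (Finset α)} {k : ℕ}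
    (hk : 1 ≤ k) (h2 : 1 < 𝓕.card)
    (h𝓕 : ∀ A ∈ 𝓕, ∀ B ∈ 𝓕, A ≠ B → (A ∩ B).card = k) :
    LinearIndependent ℚ (fun A : 𝓕 => fun a : α => if a ∈ (A : Finset α) then (1 : ℚ) else 0) := by
  classical
  have hge : ∀ A : 𝓕, (k : ℚ) ≤ (A : Finset α).card := fun A => by
    exact_mod_cast le_card_of_card_inter_eq h2 h𝓕 A.2
  rw [Fintype.linearIndependent_iff]
  intro g hrel B₀
  -- the relations `λ_B (|B| - k) + k Λ = 0`
  have hrelB : ∀ B : 𝓕,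
      g B * (((B : Finset α).card : ℚ) - k) + k * ∑ A, g A = 0 := by
    intro B
    have h := sum_mul_card_inter_eq_zero Finset.univ (fun A : 𝓕 => (A : Finset α)) g hrel B
    rw [← Finset.sum_erase_add _ _ (Finset.mem_univ B), Finset.inter_self] at h
    have hk' : ∀ A ∈ (Finset.univ : Finset 𝓕).erase B,
        g A * ((((A : Finset α)) ∩ (B : Finset α)).card : ℚ) = g A * k := by
      intro A hA
      rw [h𝓕 _ A.2 _ B.2 (fun h => (Finset.mem_erase.mp hA).1 (Subtype.ext h))]
    rw [Finset.sum_congr rfl hk', ← Finset.sum_mul, Finset.sum_erase_eq_sub (Finset.mem_univ B)]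
      at h
    linear_combination h
  -- `Λ = 0`
  have hΛ0 : ∑ A, g A = 0 := by
    by_cases hex : ∃ A : 𝓕, ((A : Finset α).card : ℚ) = k
    · obtain ⟨A, hA⟩ := hex
      have h := hrelB A
      rw [hA, sub_self, mul_zero, zero_add] at h
      have hk0 : (k : ℚ) ≠ 0 := by exact_mod_cast (by omega : k ≠ 0)
      exact (mul_eq_zero.mp h).resolve_left hk0
    · push Not at hex
      have hgt : ∀ A : 𝓕, (k : ℚ) < (A : Finset α).card := fun A =>
        lt_of_le_of_ne (hge A) (fun h => hex A h.symm)
      -- `λ_A = -k Λ / (|A| - k)`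
      have hgA : ∀ A : 𝓕, g A = -(k * ∑ A, g A) / (((A : Finset α).card : ℚ) - k) := by
        intro A
        have hpos : (((A : Finset α).card : ℚ) - k) ≠ 0 := (sub_pos.mpr (hgt A)).ne'
        rw [eq_div_iff hpos]
        linear_combination hrelB A
      by_contra hne
      have hsum : ∑ A, g A = ∑ A : 𝓕, -(k * ∑ A, g A) / (((A : Finset α).card : ℚ) - k) :=
        Finset.sum_congr rfl (fun A _ => hgA A)
      have hprod : (∑ A, g A) * (1 + k * ∑ A : 𝓕, 1 / (((A : Finset α).card : ℚ) - k)) = 0 := by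
        have : (∑ A, g A) * (k * ∑ A : 𝓕, 1 / (((A : Finset α).card : ℚ) - k)) =
            -∑ A : 𝓕, -(k * ∑ A, g A) / (((A : Finset α).card : ℚ) - k) := by
          rw [Finset.mul_sum, Finset.mul_sum, ← Finset.sum_neg_distrib]
          refine Finset.sum_congr rfl fun A _ => ?_
          ring
        rw [mul_add, mul_one, this, ← hsum, add_neg_cancel]
      have hpos : 0 < 1 + k * ∑ A : 𝓕, 1 / (((A : Finset α).card : ℚ) - k) := by
        have : 0 ≤ (k : ℚ) * ∑ A : 𝓕, 1 / (((A : Finset α).card : ℚ) - k) :=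
          mul_nonneg (by positivity)
            (Finset.sum_nonneg fun A _ => (one_div_pos.mpr (sub_pos.mpr (hgt A))).le)
        linarith
      exact hne ((mul_eq_zero.mp hprod).resolve_right hpos.ne')
  -- every `λ_B` with `|B| > k` vanishes
  have hgB : ∀ B : 𝓕, (k : ℚ) < (B : Finset α).card → g B = 0 := by
    intro B hB
    have h := hrelB B
    rw [hΛ0, mul_zero, add_zero] at h
    exact (mul_eq_zero.mp h).resolve_right (sub_pos.mpr hB).ne'
  by_cases hB₀ : (k : ℚ) < (B₀ : Finset α).card
  · exact hgB B₀ hB₀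
  · -- `|B₀| = k`: every other member is larger, so `λ_{B₀} = Λ = 0`
    have hB₀k : (B₀ : Finset α).card = k := by
      have h1 := hge B₀
      push Not at hB₀
      exact_mod_cast le_antisymm hB₀ h1
    have hothers : ∀ A : 𝓕, A ≠ B₀ → g A = 0 := by
      intro A hA
      apply hgB
      have hAk : (A : Finset α).card ≠ k := fun h =>
        hA (Subtype.ext (eq_of_card_eq_of_card_inter_eq h𝓕 A.2 B₀.2 h hB₀k))
      exact lt_of_le_of_ne (hge A) (fun h => hAk (by exact_mod_cast h.symm))
    have : ∑ A, g A = g B₀ :=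
      Finset.sum_eq_single B₀ (fun A _ hA => hothers A hA) (fun h => absurd (Finset.mem_univ _) h)
    rw [← this, hΛ0]

/-- **Theorem 14.6 (Fisher's inequality, nonuniform; Majumdar 1953).** Let `A_1, …, A_m` be distinct
subsets of an `n`-set such that `|A_i ∩ A_j| = k` for some fixed `1 ≤ k ≤ n` and every `i ≠ j`.
Then `m ≤ n`. [cite: Jukna2001, Ch. 14 §14.2.1, Theorem 14.6; Majumdar1953] -/
theorem nonuniform_fisher [Fintype α] (𝓕 : Finset (Finset α)) (k : ℕ) (hk : 1 ≤ k)
    (hkn : k ≤ Fintype.card α) (h𝓕 : ∀ A ∈ 𝓕, ∀ B ∈ 𝓕, A ≠ B → (A ∩ B).card = k) :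
    𝓕.card ≤ Fintype.card α := by
  classical
  by_cases h2 : 𝓕.card ≤ 1
  · omega
  · have hli := linearIndependent_indicator_of_card_inter_eq hk (by omega) h𝓕
    have h := hli.fintype_card_le_finrank
    rwa [Module.finrank_fintype_fun_eq_card, Fintype.card_coe] at h

/-! ### Theorem 13.4 (de Bruijn–Erdős 1948): a linear space has at least as many lines as points -/

/-- **Theorem 13.4 (de Bruijn–Erdős 1948), the inequality.** If `𝓛` is a (finite) linear space over
`X` — every line has at least two points and any two points lie on exactly one line — with at least
two lines, then `|𝓛| ≥ |X|`.  Proof by duality from Theorem 14.6 with `k = 1`: the pencils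
`A_x = {L ∈ 𝓛 : x ∈ L}` are distinct and pairwise meet in exactly one line.
[cite: Jukna2001, Ch. 13 §13.2, Theorem 13.4; Ch. 14 §14.2.1 ("In 1948,
de Bruijn and Erdős relaxed the uniformity condition")] -/
theorem card_points_le_card_lines [Fintype α] (𝓛 : Finset (Finset α))
    (htwo : ∀ L ∈ 𝓛, 2 ≤ L.card)
    (hline : ∀ x y : α, x ≠ y → ∃! L, L ∈ 𝓛 ∧ x ∈ L ∧ y ∈ L)
    (h2 : 2 ≤ 𝓛.card) :
    Fintype.card α ≤ 𝓛.card := by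
  classical
  -- the pencils
  set P : α → Finset 𝓛 := fun x => Finset.univ.filter (fun L : 𝓛 => x ∈ (L : Finset α)) with hP
  -- two distinct pencils meet in exactly one line
  have hinter : ∀ x y : α, x ≠ y → (P x ∩ P y).card = 1 := by
    intro x y hxy
    obtain ⟨L, ⟨hL, hxL, hyL⟩, huniq⟩ := hline x y hxy
    rw [Finset.card_eq_one]
    refine ⟨⟨L, hL⟩, ?_⟩
    ext M
    simp only [hP, Finset.mem_inter, Finset.mem_filter, Finset.mem_univ, true_and,
      Finset.mem_singleton]
    constructor
    · rintro ⟨hxM, hyM⟩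
      exact Subtype.ext (huniq (M : Finset α) ⟨M.2, hxM, hyM⟩)
    · rintro rfl; exact ⟨hxL, hyL⟩
  -- no line contains every point (there are two lines)
  have hproper : ∀ L ∈ 𝓛, ∃ z, z ∉ L := by
    intro L hL
    by_contra hall
    push Not at hall
    obtain ⟨L', hL', hne⟩ := Finset.exists_mem_ne h2 L
    obtain ⟨x, hx, y, hy, hxy⟩ := Finset.one_lt_card.mp (htwo L' hL')
    obtain ⟨M, -, huniq⟩ := hline x y hxy
    exact hne ((huniq L' ⟨hL', hx, hy⟩).trans (huniq L ⟨hL, hall x, hall y⟩).symm)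
  -- the pencils are pairwise distinct
  have hinj : Function.Injective P := by
    intro x y hPxy
    by_contra hxy
    obtain ⟨L, ⟨hL, hxL, hyL⟩, huniq⟩ := hline x y hxy
    obtain ⟨z, hz⟩ := hproper L hL
    have hxz : x ≠ z := fun h => hz (h ▸ hxL)
    obtain ⟨M, ⟨hM, hxM, hzM⟩, -⟩ := hline x z hxz
    have hMx : (⟨M, hM⟩ : 𝓛) ∈ P x := by
      simp only [hP, Finset.mem_filter, Finset.mem_univ, true_and]; exact hxM
    rw [hPxy] at hMx
    have hyM : y ∈ M := by
      simpa only [hP, Finset.mem_filter, Finset.mem_univ, true_and] using hMx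
    have hML : M = L := huniq M ⟨hM, hxM, hyM⟩
    exact hz (hML ▸ hzM)
  -- Fisher with `k = 1` for the family of pencils over the ground set `𝓛`
  have hF := nonuniform_fisher (α := 𝓛) (Finset.univ.image P) 1 le_rfl
    (by rw [Fintype.card_coe]; omega)
    (by
      intro A hA B hB hAB
      simp only [Finset.mem_image, Finset.mem_univ, true_and] at hA hB
      obtain ⟨x, rfl⟩ := hA
      obtain ⟨y, rfl⟩ := hB
      exact hinter x y (fun h => hAB (h ▸ rfl)))
  rwa [Finset.card_image_of_injective _ hinj, Finset.card_univ, Fintype.card_coe] at hF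

end Literature.Combinatorics.SetFamily
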